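import Summits.Parity.GeneralizedHardyLittlewood.Theses.LiouvilleMAD
import Summits.Parity.GeneralizedHardyLittlewood.Theorems.LiouvilleMADCosetDecorrelationStubNormalForm

/-!
# Disproof of `CosetDecorrelation` (stmt-Parity-13317) — cdisprove work file, cycle 1 (2026-08-16)

Crux (route `LiouvilleMAD`, rank 2; `T_j(n,n';c,M)` = the coset sum below):
`∀ c ≠ 0, ∃ ϑ < 1/4, ∃ C, ∀ M, 1 ≤ n ≠ n' ≤ 2M, j ∈ [⌊√M⌋+1, 2⌊√M⌋+2):
  |Σ_{(m,m') ∈ (M,2M]², m ≡ m' (mod j)} λ(mn+c) λ(m'n'+c)| ≤ C · M^{3/4+ϑ}`.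
Random-model size `M^{3/4}`; trivial `3·M^{3/2}` (§3); Cauchy–Schwarz line `√(V_n V_{n'}) ≈ M`.

## Findings (index; VERDICT of cycle 1: **no kill** — the statement is a clean, correctly quantified
beyond-GRH conjecture; every algebraic degeneration is excluded by `c ≠ 0`, `n ≠ n'` and the OUTERMOST
position of `c`, see §2(iv))

* §0 read-back `crux_iff` (`Iff.rfl`): the statement elaborates; no junk (`λ 0 = 0` only below `mn+c ≤ 0`,
  i.e. for `M < |c|`, absorbed by `C`); `3/4 + ϑ : ℝ`; `j ≥ ⌊√M⌋+1 ≥ 2` so no division issue downstream.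
* §1 conventions pinned (`λ 0 = 0`, `u = 0` below the shift, small values of `λ`).
* §2 LOAD-BEARING ANALYSIS.  Exact degeneration identities (all kernel-checked here):
  (i) `c = 0`: `T_j(n,n';0) = λ(n)λ(n')·V_j(M)`, `V_j(M) = Σ_{m≡m'} λ(m)λ(m') = Σ_a B(a)² ≥ 0` — a signed
  VARIANCE, independent of `(n,n')` (`shift_zero`, `selfCoset_nonneg`); so `WithoutShiftNeZero` ⟹ the
  single-modulus BDH-type bound `V_j(M) ≤ C M^{3/4+ϑ}` (`variance_bound_of_withoutShiftNeZero`), false in the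
  random model (`V_j(M) = M + (off-diagonal) ≈ M`; numerics §7: mean `V_j(M)/M = 1.00 ± 0.005`, range `[0.80, 1.56]` narrowing to `[0.90, 1.14]` at `M = 10⁷`) but NOT
  refutable in Lean: a lower bound `V_j(M) ≥ M^{1−o(1)}` for the variance of `λ` in classes mod `j ≍ √M` is an
  open anti-concentration problem (parity gives only `V ≥ #{a : #class odd} ≤ 2√M+2`).
  (ii) `n = n'`: `T_j(n,n;c) = Σ_a A_n(a)² ≥ 0` (`equalDilations_nonneg`); same status (`V_n/M ∈ [0.99,1.01]` mean).
  (iii) `n = 0` (drop `1 ≤ n`): `T_j = λ(c)·Σ_{m'} N_j(m') λ(m'n'+c)` (`dilation_zero`), `≈ (M/j)·S(n')`, random size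
  `≈ M^{1}/… `: borderline `M^{3/4+1/4}`, heuristically violated only by the margin `M^{1/4−ϑ}`; unprovable either way.
  (iv) ALIGNED SHIFTS (`n ∣ c`, `n' ∣ c`, e.g. `(n,n';c) = (1,2;2), (2,3;6), (1,q²;q²)`): `T_j(n,n';c) =
  λ(n)λ(n')·Σ_{m≡m' (j)} λ(m + c/n) λ(m' + c/n')` (`aligned_shift`) — the class-sum profile of `λ` itself against
  its own translate by the BOUNDED NONZERO lag `δ = c/n − c/n'`, `0 < |δ| < 2|c|`.  This is the deepest
  algebraic degeneration available: every multiplicative alignment `m'n'+c = q·(mn+c)` along a coset row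
  `m' = m + tj` needs `nn'tj ∣ c(n'−n)`, impossible once `j > |c|` because `c` is quantified OUTSIDE `M`
  (uniformity in `c` is not claimed — correctly).  Hence no row of the coset is ever algebraically biased, the
  square-coincidence set `{(mn+c)(m'n'+c) = □}` has `≪ √M log M` points per coset (ideator 1 §5), and a
  refutation would need a genuine Ω-theorem for signed sums of `≈ √M` two-point Chowla sums `C(δ + tj)`.
  (vi) NO UNIVERSAL (sequence-independent) OBSTRUCTION: a random `±1` sequence in place of `λ` satisfies the crux
  almost surely with every `ϑ > 0` (sub-Gaussian `T_j`, variance `#P_j ≤ 2M^{3/2}`, union bound over the `≤ 4M^{5/2}`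
  triples `(n,n',j)` per scale and over `M`), so no Roth-type discrepancy argument can bite (Roth's AP-discrepancy
  floor `N^{1/4}` and the Welch floor `M^{3/4}` of §3 are the only universal lower bounds, both below the claim);
  any disproof must use arithmetic of `λ` — i.e. exhibit pretender-like behaviour (§6b).
  (vii) SHIFT SCALING `T_j(gn,gn';gc) = T_j(n,n';c)` (`T_scale`): `c = ±1` are the hardest shifts; `∀ c` adds only the
  dilations not divisible by `|c|`.
  (v) `n ≤ 2M`, `j < 2(⌊√M⌋+1)`: NOT load-bearing in the random model (the bound is insensitive to the size of
  `n`; for `j ≥ 2Q` the coset has fewer rows).  `j ≥ ⌊√M⌋+1` IS (for `j ≤ M^{2κ}` the sum `≈ M/√j` exceeds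
  `M^{1−κ}`; at `j = 1` it is the product `S(n)S(n')`, §4).  `ϑ < 1/4`: the conclusion is open for EVERY
  `ϑ < 3/4`; for `ϑ ≥ 1/4` it would follow from a single-modulus Barban–Davenport–Halberstam bound
  `V_n ≪ M^{1+2(ϑ−1/4)}` (Hooley/KMT give `o(M^{3/2})` only, memo F6(e)); `ϑ = 3/4` is trivial (§3).
* §3 TIGHTNESS: trivial bound `|T_j| ≤ (2M/j+1)M ≤ 3M^{3/2}` (`trivial_bound`); Welch floor (lead's landed
  `stub_welchBound`): `V_n ≍ M ∀ n ≤ 2M` forces `max_{n≠n'}|T_j| ≥ M^{3/4}/4`, so `ϑ ≥ 0` is necessary GIVEN the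
  (numerically solid, unproved) variance law; numerics: `rms_{j}|T_j| = (0.75–0.87)·M^{3/4}` flat over
  `10⁴ ≤ M ≤ 10⁷`, `max_j |T_j|/M^{3/4} ∈ [1.9, 3.5]` growing like `√(2 log #j)` only.
* §4 NATURAL STRENGTHENINGS: (a) uniform constant `C = 1, ϑ = 0` from `M = 1`: false at `M = 2` (`not_uniformConstant`,
  small model); (b) ALL moduli `j ≥ 1`: at `j = 1` the sum is the product `S(n)S(n')` (`modulus_one`), random size
  `M` — heuristically false, unprovable; (c) NO UPPER LIMIT on `j`: for `j > M` the coset sum IS the dilated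
  two-point sum `Σ_m λ(mn+c)λ(mn'+c)` (`large_modulus_eq_diagonal`), i.e. the strengthening swallows the node
  `DilatedChowla` pointwise; (d) uniformity in `c` (`∃ ϑ C ∀ c`): false iff some progression window of length `M`
  carries constant `λ` — Chowla-true, unprovable; not claimed by the crux.
* §5 LINE `SketchIdeator3` (lead prover-line-stmt-Parity-13317-0): joint sufficiency `K2 → K1 → crux` is
  kernel-checked by the lead (`CosetDecorrelation_of`); periphery P1–P4 LANDED.  K1 (mean-corrected crux) has
  exactly the crux's status (all of §2 applies verbatim: at aligned shifts the level-1 term is `S(1)S(1)/j`-sized,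
  `≤ 0.25 M^{3/4}` numerically).  K2 (`|S(n)| ≤ C M^{3/4−κ/2} ∀ n ≤ 2M`) is NEW DEBT not implied by the crux
  (the crux gives only the ℓ¹ average, lead's `stub_calibrationL1`); at `n = 1` it is quasi-RH(`3/4−κ/2`) —
  irrefutable without disproving RH; at `n ≍ M` it is Montgomery-grade but has a margin `M^{1/4−κ/2}` over the
  random size `√M`: numerics §7C `max_{n} |S(n)|/√M = 3.07` (rms `0.96`, `√(2 log #n) = 3.64`) over all `n ≤ 400`,
  300 random and 48 structured `n ≤ 2M` (primorial multiples, `2^k`, `n ∈ {M, M±1, 2M, 2M−1, Q, Q²}`) at `M = 10⁵`,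
  a factor `5.8` below `M^{1/4} = 17.8`; no known Ω-theorem (Friedlander–Granville–Hildebrand–Maier type, size
  `(x/q)^{1/2+o(1)}`) reaches `(x/q)^{3/4}`.  New periphery stubs P6 `stub_welchFloor` (general weights; arithmetic
  checked: `M⁴/(2√M+2) − 8M³` over `4M²` pairs gives `max|T| ≥ 0.35M^{3/4} > M^{3/4}/4` for `M ≳ 10³`) and P7
  `stub_meanFreeEngine` (divisor switch with mean-free weights; diagonal `Σλλ' − SS'/M`, fans empty for
  `|k| > M/Q`; its one-point input `|S(n)| ≤ CM^{1−κ}` is quasi-RH(`1−κ`)-grade at `n = 1`, the node's depth) are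
  correctly stated.  No stub broken; nothing misstated (K1's `/ (j:ℝ)` has `j ≥ 2`).
* §6 NEAR-MISSES / reformulations for ideators: the bounded-lag core `X_j(δ) = Σ_{m ≡ m'+δ (j)} λ(m)λ(m')
  = Σ_{h ≡ δ (j), |h|<M} C_M(h)` (signed sum of `≈ 2√M` Chowla sums along an AP of shifts) IS the crux at
  `(1,2;2)`; the real-character pretender `λ → χ (cond q ∣ j)` gives `|T_j^χ| ≍ M^{3/2}/(jq)` (Jacobsthal),
  recorded as the docstring computation `pretender_model` (not formalised: a statement about the model, not `λ`).
* §7 NUMERICS (kit job j016671, 2009 s, evidence `compute-j016671.json` on the item; script `num/coset_disprove.py`: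
  λ by prime-power sign sieve to 8·10⁷, check `L(10⁶) = −530` ✓; segmented AP sieve for arguments to 8·10¹⁰;
  self-test against brute force).  ALL columns random-model, no drift in any family:
  A. `max_j |T_j|/M^{3/4}` [rms_j] for `M = 10⁴, 3·10⁴, 10⁵, 3·10⁵, 10⁶, 3·10⁶, 10⁷` (`#j = Q = 101 … 3163`):
     aligned `(1,2;2)` lag 1: 2.18 2.17 2.60 2.85 2.81 2.97 3.53 [0.78–0.86];  `(2,3;6)` lag 1: identical to 3 digits
     (same profile pair, = `aligned_shift`);  `(1,3;3)` lag 2: 2.73 1.86 2.65 3.09 3.09 2.92 — [0.77–0.84];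
     `(1,4;4)` lag 3: 2.14 2.36 2.82 2.55 2.95 2.73 — [0.77–0.84];  generic `(1,2;1)`: 2.40 2.28 2.89 3.03 2.86 3.45 3.25
     [0.77–0.86];  `(2,3;1)`: 2.28 2.74 2.36 2.71 3.31 2.73 — [0.75–0.87].  The max tracks `rms·√(2 log #j)`
     (`0.8·3.0 = 2.4` at `10⁴`, `0.84·4.0 = 3.4` at `10⁷`); fitted exponent of the max over 3 decades `0.82`, of the rms
     `0.76`.  Variances: `V_j(M)/M` (c = 0) min/mean/max = 0.80/1.00/1.56 (`10⁴`) → 0.90/1.00/1.14 (`10⁷`);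
     `V_n/M` mean `0.994–1.007` for every `(n,c)` tested (`M ≤ 10⁶`).
  B. large dilations, `c = ±1`, `M = 2·10⁴, 5·10⁴, 10⁵, 2·10⁵`, pairs `(M,M+1), (M+1,2M), (2M−1,2M), (1,2M),
     (2,2M−1), (Q,2Q−1), (Q⌊M/Q⌋, Q⌊M/Q⌋+Q), (M/2,M)`: `max_j|T_j|/M^{3/4} ∈ [1.88, 3.62]`, rms `[0.74, 0.96]`,
     `|S(n)|/√M ≤ 2.9` — identical law at `modulus jn ≍ M^{3/2} > (size)^{3/4}`, where GRH is silent.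
  C. K2 scan (above, §5).  D. conductor-in-`j` (`(1,2;1)`, `M = 10⁵…10⁷`): for `q ∈ {3,4,5,7,8,11,19,43,67,163}` the
     mean of `|T_j|/M^{3/4}` over `j ≡ 0 (q)` stays in `[0.51, 0.90]` against the global `0.65–0.69`, best ranks
     scattered (e.g. `q = 163`: ranks 115/317, 61/548, 2/1001, 374/1733, 297/3163) — no pretender shadow at any `q`.
  Earlier runs (ideators 1–2, refuters g43/g44): same constants at `M ≤ 6.4·10⁵`; this run adds 1.2 decades, the
  aligned cores, `n ≍ M` at `M = 2·10⁵`, and the K2 scan.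

LANDED from this file: `Theorems/CosetDecorrelation/Negative/CosetDecorrelationDegenerations.lean` (p99699, ACCEPTED
@79d43234d35e: §0–§2 — `u/pairs/cosetW/T`, `crux_iff`, `aligned_shift`, `shift_zero`, `abs_shift_zero`, `selfCoset_nonneg`,
`sq_sum_div_le_selfCoset`, `equalDilations_nonneg`, `dilation_zero`, `Without*`/`VarianceBound` reductions; importable by
skeletons and ideators).  READY (attached as item evidence `CosetDecorrelationWindow.lean`, to land at
`…/Negative/CosetDecorrelationWindow.lean`): §3–§4 + `T_scale`.

Nothing in this file asserts the crux or its negation; `sorry` appears nowhere.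
-/

namespace Summit.Parity.GeneralizedHardyLittlewood.Cruxes.CosetDecorrelation.Disproof

open Summit.Parity.GeneralizedHardyLittlewood.Theses.LiouvilleMAD
open Summit.Parity.GeneralizedHardyLittlewood.Theorems.CosetDecorrelation.FareyLevelMeanCoupling
  (normalForm_coset_eq_classInner normalForm_sum_classSum)
open Finset

/-! ## §0 The object and the read-back -/

/-- `u n c m = λ(mn+c)` as a real number (junk value `0` when `mn + c ≤ 0`, since `λ 0 = 0`). -/
noncomputable def u (n : ℕ) (c : ℤ) (m : ℕ) : ℝ :=
  (ArithmeticFunction.liouville (Int.toNat ((m : ℤ) * n + c)) : ℝ)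

/-- `λ` itself as a real sequence. -/
noncomputable def lam (m : ℕ) : ℝ := (ArithmeticFunction.liouville m : ℝ)

/-- The coset `P_j(M) = {(m,m') ∈ (M,2M]² : m ≡ m' (mod j)}`. -/
def pairs (M j : ℕ) : Finset (ℕ × ℕ) :=
  (Ioc M (2 * M) ×ˢ Ioc M (2 * M)).filter (fun p : ℕ × ℕ => p.1 ≡ p.2 [MOD j])

/-- General-weight coset sum `Σ_{(m,m') ∈ P_j(M)} f(m) g(m')`. -/
noncomputable def cosetW (f g : ℕ → ℝ) (M j : ℕ) : ℝ := ∑ p ∈ pairs M j, f p.1 * g p.2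

/-- The crux's sum `T_j(n,n';c,M)`. -/
noncomputable def T (c : ℤ) (n n' M j : ℕ) : ℝ := cosetW (u n c) (u n' c) M j

/-- READ-BACK: the crux is literally the uniform bound on `T` (definitional unfolding). -/
theorem crux_iff :
    CosetDecorrelation ↔
      ∀ c : ℤ, c ≠ 0 → ∃ ϑ : ℝ, ϑ < 1 / 4 ∧ ∃ C : ℝ, ∀ M n n' j : ℕ, 1 ≤ n → 1 ≤ n' → n ≠ n' →
        n ≤ 2 * M → n' ≤ 2 * M → Nat.sqrt M + 1 ≤ j → j < 2 * (Nat.sqrt M + 1) →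
          |T c n n' M j| ≤ C * (M : ℝ) ^ (3 / 4 + ϑ) :=
  Iff.rfl

/-- Class inner product (lead's landed `normalForm_coset_eq_classInner`, restated for `cosetW`):
`cosetW f g M j = Σ_{a<j} A_f(a) A_g(a)`. -/
theorem cosetW_eq_classInner (f g : ℕ → ℝ) (M j : ℕ) (hj : 1 ≤ j) :
    cosetW f g M j = ∑ a ∈ range j,
      (∑ m ∈ (Ioc M (2 * M)).filter (fun m => m ≡ a [MOD j]), f m) *
        (∑ m ∈ (Ioc M (2 * M)).filter (fun m => m ≡ a [MOD j]), g m) :=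
  normalForm_coset_eq_classInner f g M j hj

/-! ## §1 Conventions -/

/-- `λ(0) = 0` (Mathlib's `ArithmeticFunction` convention). -/
theorem liouville_zero : ArithmeticFunction.liouville 0 = 0 := by simp

/-- Below the shift (`mn + c ≤ 0`) the summand is the junk value `0`, not `±1`. -/
theorem u_of_nonpos {n : ℕ} {c : ℤ} {m : ℕ} (h : (m : ℤ) * n + c ≤ 0) : u n c m = 0 := by
  unfold u
  rw [Int.toNat_of_nonpos h]
  simp

/-- `|λ(k)| ≤ 1` in the real spelling. -/
theorem abs_lam_le_one (k : ℕ) : |(ArithmeticFunction.liouville k : ℝ)| ≤ 1 := by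
  rcases eq_or_ne k 0 with h | h
  · subst h; simp
  · rw [ArithmeticFunction.liouville_apply h]; push_cast
    rw [abs_pow, abs_neg, abs_one, one_pow]

/-- `|λ(mn+c)| ≤ 1` in the real spelling (junk value included). -/
theorem abs_u_le_one (n : ℕ) (c : ℤ) (m : ℕ) : |u n c m| ≤ 1 := abs_lam_le_one _

/-- `λ(2) = −1`. -/
theorem liouville_two : ArithmeticFunction.liouville 2 = -1 := by
  rw [ArithmeticFunction.liouville_apply (by norm_num),
    ArithmeticFunction.cardFactors_apply_prime Nat.prime_two]; norm_num
/-- `λ(3) = −1`. -/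
theorem liouville_three : ArithmeticFunction.liouville 3 = -1 := by
  rw [ArithmeticFunction.liouville_apply (by norm_num),
    ArithmeticFunction.cardFactors_apply_prime Nat.prime_three]; norm_num
/-- `λ(4) = 1`. -/
theorem liouville_four : ArithmeticFunction.liouville 4 = 1 := by
  rw [show (4 : ℕ) = 2 * 2 by norm_num, ArithmeticFunction.liouville_apply_mul, liouville_two]; norm_num
/-- `λ(5) = −1`. -/
theorem liouville_five : ArithmeticFunction.liouville 5 = -1 := by
  rw [ArithmeticFunction.liouville_apply (by norm_num),
    ArithmeticFunction.cardFactors_apply_prime Nat.prime_five]; norm_num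
/-- `λ(7) = −1`. -/
theorem liouville_seven : ArithmeticFunction.liouville 7 = -1 := by
  rw [ArithmeticFunction.liouville_apply (by norm_num),
    ArithmeticFunction.cardFactors_apply_prime (by norm_num : Nat.Prime 7)]; norm_num
/-- `λ(9) = 1`. -/
theorem liouville_nine : ArithmeticFunction.liouville 9 = 1 := by
  rw [show (9 : ℕ) = 3 * 3 by norm_num, ArithmeticFunction.liouville_apply_mul, liouville_three]; norm_num

/-! ## §2 Load-bearing analysis: exact degenerations -/

/-- `Int.toNat` commutes with multiplication by a natural number (also in the junk range). -/
theorem toNat_natCast_mul (n : ℕ) (x : ℤ) : Int.toNat ((n : ℤ) * x) = n * Int.toNat x := by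
  rcases le_or_gt 0 x with hx | hx
  · lift x to ℕ using hx
    rw [Int.toNat_natCast, ← Nat.cast_mul, Int.toNat_natCast]
  · rw [Int.toNat_of_nonpos hx.le, mul_zero,
      Int.toNat_of_nonpos (mul_nonpos_of_nonneg_of_nonpos (by positivity) hx.le)]

/-- MULTIPLICATIVE PULL-OUT: if `c = n·a` then `λ(mn + c) = λ(n)·λ(m + a)` for all `m`
(complete multiplicativity; consistent in the junk range since both sides vanish there). -/
theorem u_of_dvd (n : ℕ) (a : ℤ) (m : ℕ) :
    u n (n * a) m = (ArithmeticFunction.liouville n : ℝ) *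
      (ArithmeticFunction.liouville (Int.toNat ((m : ℤ) + a)) : ℝ) := by
  unfold u
  rw [show (m : ℤ) * n + n * a = (n : ℤ) * ((m : ℤ) + a) by ring, toNat_natCast_mul,
    ArithmeticFunction.liouville_apply_mul]
  push_cast; ring

/-- (iv) ALIGNED SHIFTS.  If `c = n·a = n'·b` then
`T_j(n,n';c) = λ(n)λ(n') · Σ_{m≡m' (j)} λ(m+a) λ(m'+b)`: the coset sum of `λ` against ITSELF with the two
windows translated by `a` and `b` — a class-profile autocorrelation at the bounded lag `a − b`. -/
theorem aligned_shift (n n' : ℕ) (a b c : ℤ) (ha : c = n * a) (hb : c = n' * b) (M j : ℕ) :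
    T c n n' M j = (ArithmeticFunction.liouville n : ℝ) * (ArithmeticFunction.liouville n' : ℝ) *
      cosetW (fun m => (ArithmeticFunction.liouville (Int.toNat ((m : ℤ) + a)) : ℝ))
        (fun m => (ArithmeticFunction.liouville (Int.toNat ((m : ℤ) + b)) : ℝ)) M j := by
  unfold T cosetW
  rw [mul_sum]
  refine sum_congr rfl fun p _ => ?_
  rw [show u n c p.1 = u n (n * a) p.1 by rw [← ha], show u n' c p.2 = u n' (n' * b) p.2 by rw [← hb],
    u_of_dvd, u_of_dvd]
  ring

/-- (i) SHIFT ZERO.  `T_j(n,n';0) = λ(n)λ(n') · Σ_{m ≡ m' (j)} λ(m)λ(m')` — the sign `λ(nn')` times a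
quantity independent of `(n,n')`. -/
theorem shift_zero (n n' M j : ℕ) :
    T 0 n n' M j = (ArithmeticFunction.liouville n : ℝ) * (ArithmeticFunction.liouville n' : ℝ) *
      cosetW lam lam M j := by
  rw [aligned_shift n n' 0 0 0 (by simp) (by simp) M j]
  congr 1

/-- A coset sum of a sequence against ITSELF is a sum of squares of class sums: nonnegative. -/
theorem selfCoset_nonneg (f : ℕ → ℝ) (M j : ℕ) (hj : 1 ≤ j) : 0 ≤ cosetW f f M j := by
  rw [cosetW_eq_classInner f f M j hj]
  exact sum_nonneg fun a _ => mul_self_nonneg _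

/-- … and it dominates the level-one term: `cosetW f f ≥ (Σ f)²/j` (mean coupling with `f = g`). -/
theorem sq_sum_div_le_selfCoset (f : ℕ → ℝ) (M j : ℕ) (hj : 1 ≤ j) :
    (∑ m ∈ Ioc M (2 * M), f m) ^ 2 / j ≤ cosetW f f M j := by
  rw [cosetW_eq_classInner f f M j hj]
  have hjpos : (0 : ℝ) < j := by exact_mod_cast hj
  rw [div_le_iff₀ hjpos, ← normalForm_sum_classSum f M j hj]
  have := sum_mul_sq_le_sq_mul_sq (range j) (fun _ => (1 : ℝ))
    (fun a => ∑ m ∈ (Ioc M (2 * M)).filter (fun m => m ≡ a [MOD j]), f m)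
  simp only [one_pow, sum_const, card_range, nsmul_eq_mul, mul_one, one_mul] at this
  calc (∑ a ∈ range j, ∑ m ∈ (Ioc M (2 * M)).filter (fun m => m ≡ a [MOD j]), f m) ^ 2
      ≤ (j : ℝ) * ∑ a ∈ range j, (∑ m ∈ (Ioc M (2 * M)).filter (fun m => m ≡ a [MOD j]), f m) ^ 2 := this
    _ = (∑ a ∈ range j, (∑ m ∈ (Ioc M (2 * M)).filter (fun m => m ≡ a [MOD j]), f m) *
          (∑ m ∈ (Ioc M (2 * M)).filter (fun m => m ≡ a [MOD j]), f m)) * j := by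
        rw [mul_comm]; simp only [sq]

/-- (i′) At `c = 0` the ABSOLUTE VALUE of the crux's sum is the variance `V_j(M) = Σ_{m≡m'} λ(m)λ(m')`,
the same for every pair of nonzero dilations. -/
theorem abs_shift_zero {n n' : ℕ} (hn : 1 ≤ n) (hn' : 1 ≤ n') (M j : ℕ) (hj : 1 ≤ j) :
    |T 0 n n' M j| = cosetW lam lam M j := by
  rw [shift_zero, abs_mul, abs_mul, abs_of_nonneg (selfCoset_nonneg lam M j hj)]
  have h1 : |(ArithmeticFunction.liouville n : ℝ)| = 1 := by
    rw [ArithmeticFunction.liouville_apply (by omega)]; push_cast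
    rw [abs_pow, abs_neg, abs_one, one_pow]
  have h2 : |(ArithmeticFunction.liouville n' : ℝ)| = 1 := by
    rw [ArithmeticFunction.liouville_apply (by omega)]; push_cast
    rw [abs_pow, abs_neg, abs_one, one_pow]
  rw [h1, h2, one_mul, one_mul]

/-- (ii) EQUAL DILATIONS.  `T_j(n,n;c) = Σ_a A_n(a)² ≥ (Σ_m λ(mn+c))²/j ≥ 0`. -/
theorem equalDilations_nonneg (c : ℤ) (n M j : ℕ) (hj : 1 ≤ j) : 0 ≤ T c n n M j :=
  selfCoset_nonneg _ M j hj

/-- `T_j(n,n;c) ≥ S(n)²/j`: the equal-dilation sum dominates its own level-one term. -/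
theorem sq_mean_le_equalDilations (c : ℤ) (n M j : ℕ) (hj : 1 ≤ j) :
    (∑ m ∈ Ioc M (2 * M), u n c m) ^ 2 / j ≤ T c n n M j :=
  sq_sum_div_le_selfCoset _ M j hj

/-- (iii) DILATION ZERO (drop `1 ≤ n`).  `T_j(0,n';c) = λ(c) · Σ_{(m,m') ∈ P_j} λ(m'n'+c)`: the first
factor is the constant `λ(c)` and the sum is `Σ_{m'} N_j(m') λ(m'n'+c)`, `N_j(m') = #{m ≡ m' (j)} ≈ M/j`. -/
theorem dilation_zero (c : ℤ) (n' M j : ℕ) :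
    T c 0 n' M j = (ArithmeticFunction.liouville (Int.toNat c) : ℝ) * ∑ p ∈ pairs M j, u n' c p.2 := by
  unfold T cosetW
  rw [mul_sum]
  refine sum_congr rfl fun p _ => ?_
  simp [u]

/-- (vii) SHIFT SCALING.  `λ(m·gn + gc) = λ(g)·λ(mn + c)`: scaling shift and dilation together pulls out `λ(g)`. -/
theorem u_scale (g n : ℕ) (c : ℤ) (m : ℕ) :
    u (g * n) ((g : ℤ) * c) m = (ArithmeticFunction.liouville g : ℝ) * u n c m := by
  unfold u
  rw [show (m : ℤ) * ((g * n : ℕ) : ℤ) + (g : ℤ) * c = (g : ℤ) * ((m : ℤ) * n + c) by push_cast; ring,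
    toNat_natCast_mul, ArithmeticFunction.liouville_apply_mul]
  push_cast; ring

/-- … hence `T_j(gn, gn'; gc) = T_j(n, n'; c)` for `g ≥ 1`: the crux at ONE shift `c₀` contains the crux at the shift
`sign c₀` for all dilations `≤ 2M/|c₀|`, and the crux at shift `±1` gives every other shift on the dilations divisible
by `|c|`.  The shifts `c = ±1` are the hardest instances; `∀ c` adds only the non-divisible dilations. -/
theorem T_scale {g : ℕ} (hg : 1 ≤ g) (c : ℤ) (n n' M j : ℕ) :
    T ((g : ℤ) * c) (g * n) (g * n') M j = T c n n' M j := by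
  have hsq : (ArithmeticFunction.liouville g : ℝ) * (ArithmeticFunction.liouville g : ℝ) = 1 := by
    rw [ArithmeticFunction.liouville_apply (by omega)]; push_cast
    rw [← pow_add, ← two_mul, pow_mul, neg_one_sq, one_pow]
  unfold T cosetW
  refine sum_congr rfl fun p _ => ?_
  rw [u_scale, u_scale]
  calc (ArithmeticFunction.liouville g : ℝ) * u n c p.1 * ((ArithmeticFunction.liouville g : ℝ) * u n' c p.2)
      = ((ArithmeticFunction.liouville g : ℝ) * (ArithmeticFunction.liouville g : ℝ)) * (u n c p.1 * u n' c p.2) := by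
        ring
    _ = u n c p.1 * u n' c p.2 := by rw [hsq, one_mul]

/-! ### The dropped-hypothesis variants, by name, and what they reduce to -/

/-- The crux with `c ≠ 0` dropped. -/
def WithoutShiftNeZero : Prop :=
  ∀ c : ℤ, ∃ ϑ : ℝ, ϑ < 1 / 4 ∧ ∃ C : ℝ, ∀ M n n' j : ℕ, 1 ≤ n → 1 ≤ n' → n ≠ n' →
    n ≤ 2 * M → n' ≤ 2 * M → Nat.sqrt M + 1 ≤ j → j < 2 * (Nat.sqrt M + 1) →
      |T c n n' M j| ≤ C * (M : ℝ) ^ (3 / 4 + ϑ)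

/-- The crux with `n ≠ n'` dropped. -/
def WithoutDilationsNe : Prop :=
  ∀ c : ℤ, c ≠ 0 → ∃ ϑ : ℝ, ϑ < 1 / 4 ∧ ∃ C : ℝ, ∀ M n n' j : ℕ, 1 ≤ n → 1 ≤ n' →
    n ≤ 2 * M → n' ≤ 2 * M → Nat.sqrt M + 1 ≤ j → j < 2 * (Nat.sqrt M + 1) →
      |T c n n' M j| ≤ C * (M : ℝ) ^ (3 / 4 + ϑ)

/-- Single-modulus variance bound for `λ` in the classes mod `j ≍ √M` of a dyadic block:
`V_j(M) = Σ_{a mod j} (Σ_{m ∈ (M,2M], m≡a} λ(m))² ≤ C·M^{3/4+ϑ}` for some `ϑ < 1/4`.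
FALSE in the random model (`V_j(M) = M + off-diagonal ≈ M`, numerics §7) — a power ANTI-concentration
statement nobody can prove: this is exactly why `c ≠ 0` cannot be certified load-bearing in Lean. -/
def VarianceBound : Prop :=
  ∃ ϑ : ℝ, ϑ < 1 / 4 ∧ ∃ C : ℝ, ∀ M j : ℕ, 1 ≤ M → Nat.sqrt M + 1 ≤ j → j < 2 * (Nat.sqrt M + 1) →
    cosetW lam lam M j ≤ C * (M : ℝ) ^ (3 / 4 + ϑ)

/-- `c ≠ 0` dropped ⟹ the variance bound (take `c = 0`, `(n,n') = (1,2)`). -/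
theorem varianceBound_of_withoutShiftNeZero (h : WithoutShiftNeZero) : VarianceBound := by
  obtain ⟨ϑ, hϑ, C, hC⟩ := h 0
  refine ⟨ϑ, hϑ, C, fun M j hM hj1 hj2 => ?_⟩
  have := hC M 1 2 j le_rfl (by norm_num) (by norm_num) (by omega) (by omega) hj1 hj2
  rwa [abs_shift_zero le_rfl (by norm_num) M j (by omega)] at this

/-- Variance of the progression profile: `V_n(c;M,j) = T_j(n,n;c) ≤ C M^{3/4+ϑ}` — the `n = n'` variant
reduces to this, equally false in the random model (`V_n/M ≈ 1`, §7) and equally unprovable. -/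
def ProgressionVarianceBound : Prop :=
  ∀ c : ℤ, c ≠ 0 → ∃ ϑ : ℝ, ϑ < 1 / 4 ∧ ∃ C : ℝ, ∀ M n j : ℕ, 1 ≤ n → n ≤ 2 * M →
    Nat.sqrt M + 1 ≤ j → j < 2 * (Nat.sqrt M + 1) → T c n n M j ≤ C * (M : ℝ) ^ (3 / 4 + ϑ)

/-- `n ≠ n'` dropped ⟹ the progression-variance bound (take `n = n'`). -/
theorem progressionVarianceBound_of_withoutDilationsNe (h : WithoutDilationsNe) :
    ProgressionVarianceBound := by
  intro c hc
  obtain ⟨ϑ, hϑ, C, hC⟩ := h c hc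
  refine ⟨ϑ, hϑ, C, fun M n j hn hnM hj1 hj2 => ?_⟩
  exact (le_abs_self _).trans (hC M n n j hn hn hnM hnM hj1 hj2)


/-! ## §3 Tightness: the trivial bound (exponent `3/2`) -/

/-- Each class of `(M,2M]` modulo `j ≥ 1` has at most `2M/j + 1` elements (inject by `m ↦ m / j`).
(Ported from `SketchIdeator3.card_class_le`.) -/
theorem card_class_le (M j a : ℕ) (_hj : 1 ≤ j) :
    (((Ioc M (2 * M)).filter (fun m => m ≡ a [MOD j])).card : ℝ) ≤ 2 * M / j + 1 := by
  have hinj : Set.InjOn (fun m => m / j)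
      (((Ioc M (2 * M)).filter (fun m => m ≡ a [MOD j]) : Finset ℕ) : Set ℕ) := by
    intro m hm m' hm' h
    rw [mem_coe, mem_filter] at hm hm'
    have hmod : m % j = m' % j := hm.2.trans hm'.2.symm
    have h' : m / j = m' / j := h
    calc m = j * (m / j) + m % j := (Nat.div_add_mod m j).symm
      _ = j * (m' / j) + m' % j := by rw [h', hmod]
      _ = m' := Nat.div_add_mod m' j
  have hmaps : Set.MapsTo (fun m => m / j)
      (((Ioc M (2 * M)).filter (fun m => m ≡ a [MOD j]) : Finset ℕ) : Set ℕ)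
      ((range (2 * M / j + 1) : Finset ℕ) : Set ℕ) := by
    intro m hm
    rw [mem_coe, mem_filter, mem_Ioc] at hm
    rw [mem_coe, mem_range]
    exact Nat.lt_succ_of_le (Nat.div_le_div_right hm.1.2)
  have hcard := card_le_card_of_injOn (fun m => m / j) hmaps hinj
  rw [card_range] at hcard
  have hdiv : ((2 * M / j : ℕ) : ℝ) ≤ 2 * (M : ℝ) / j := by
    have := Nat.cast_div_le (m := 2 * M) (n := j) (α := ℝ)
    push_cast at this
    exact this
  calc (((Ioc M (2 * M)).filter (fun m => m ≡ a [MOD j])).card : ℝ)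
      ≤ ((2 * M / j + 1 : ℕ) : ℝ) := by exact_mod_cast hcard
    _ = ((2 * M / j : ℕ) : ℝ) + 1 := by push_cast; ring
    _ ≤ 2 * (M : ℝ) / j + 1 := by linarith

/-- The classes partition `(M,2M]`: `Σ_{a<j} #class_a = M`. (Ported from `SketchIdeator3`.) -/
theorem sum_card_class (M j : ℕ) (hj : 1 ≤ j) :
    ∑ a ∈ range j, (((Ioc M (2 * M)).filter (fun m => m ≡ a [MOD j])).card : ℝ) = M := by
  have h := normalForm_sum_classSum (fun _ => (1 : ℝ)) M j hj
  simp only [sum_const, nsmul_eq_mul, mul_one, Nat.card_Ioc] at h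
  rw [h, show 2 * M - M = M by omega]

/-- `|A_f(a)| ≤ #class_a` for weights bounded by `1`. -/
theorem abs_classSum_le (f : ℕ → ℝ) (hf : ∀ m, |f m| ≤ 1) (M j a : ℕ) :
    |∑ m ∈ (Ioc M (2 * M)).filter (fun m => m ≡ a [MOD j]), f m|
      ≤ (((Ioc M (2 * M)).filter (fun m => m ≡ a [MOD j])).card : ℝ) := by
  calc |∑ m ∈ (Ioc M (2 * M)).filter (fun m => m ≡ a [MOD j]), f m|
      ≤ ∑ m ∈ (Ioc M (2 * M)).filter (fun m => m ≡ a [MOD j]), |f m| := abs_sum_le_sum_abs _ _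
    _ ≤ ∑ m ∈ (Ioc M (2 * M)).filter (fun m => m ≡ a [MOD j]), (1 : ℝ) := sum_le_sum fun m _ => hf m
    _ = _ := by simp

/-- TRIVIAL BOUND (general weights bounded by `1`): `|cosetW f g M j| ≤ (2M/j + 1)·M`. -/
theorem abs_cosetW_le (f g : ℕ → ℝ) (hf : ∀ m, |f m| ≤ 1) (hg : ∀ m, |g m| ≤ 1) (M j : ℕ)
    (hj : 1 ≤ j) : |cosetW f g M j| ≤ (2 * (M : ℝ) / j + 1) * M := by
  rw [cosetW_eq_classInner f g M j hj]
  calc |∑ a ∈ range j, (∑ m ∈ (Ioc M (2 * M)).filter (fun m => m ≡ a [MOD j]), f m) *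
          (∑ m ∈ (Ioc M (2 * M)).filter (fun m => m ≡ a [MOD j]), g m)|
      ≤ ∑ a ∈ range j, |(∑ m ∈ (Ioc M (2 * M)).filter (fun m => m ≡ a [MOD j]), f m) *
          (∑ m ∈ (Ioc M (2 * M)).filter (fun m => m ≡ a [MOD j]), g m)| := abs_sum_le_sum_abs _ _
    _ ≤ ∑ a ∈ range j, (2 * (M : ℝ) / j + 1) *
          (((Ioc M (2 * M)).filter (fun m => m ≡ a [MOD j])).card : ℝ) := by
        refine sum_le_sum fun a _ => ?_
        rw [abs_mul]
        calc |∑ m ∈ (Ioc M (2 * M)).filter (fun m => m ≡ a [MOD j]), f m| *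
              |∑ m ∈ (Ioc M (2 * M)).filter (fun m => m ≡ a [MOD j]), g m|
            ≤ (((Ioc M (2 * M)).filter (fun m => m ≡ a [MOD j])).card : ℝ) *
                (((Ioc M (2 * M)).filter (fun m => m ≡ a [MOD j])).card : ℝ) :=
              mul_le_mul (abs_classSum_le f hf M j a) (abs_classSum_le g hg M j a) (abs_nonneg _)
                (Nat.cast_nonneg _)
          _ ≤ (2 * (M : ℝ) / j + 1) * (((Ioc M (2 * M)).filter (fun m => m ≡ a [MOD j])).card : ℝ) :=
              mul_le_mul_of_nonneg_right (card_class_le M j a hj) (Nat.cast_nonneg _)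
    _ = (2 * (M : ℝ) / j + 1) * M := by rw [← mul_sum, sum_card_class M j hj]

/-- `√M < ⌊√M⌋ + 1` as reals. -/
theorem sqrt_lt_natSqrt_add_one (M : ℕ) : Real.sqrt M < ((Nat.sqrt M + 1 : ℕ) : ℝ) := by
  have h : (M : ℝ) < ((Nat.sqrt M + 1 : ℕ) : ℝ) ^ 2 := by exact_mod_cast Nat.lt_succ_sqrt' M
  calc Real.sqrt M < Real.sqrt (((Nat.sqrt M + 1 : ℕ) : ℝ) ^ 2) := Real.sqrt_lt_sqrt (Nat.cast_nonneg _) h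
    _ = ((Nat.sqrt M + 1 : ℕ) : ℝ) := Real.sqrt_sq (Nat.cast_nonneg _)

/-- TRIVIAL BOUND in the crux's window: `|T_j(n,n';c,M)| ≤ 3·M^{3/2}` for `j ≥ ⌊√M⌋+1` — the crux's
conclusion with `ϑ = 3/4` holds for free; everything between `3/4 + ϑ`, `ϑ < 1/4`, and `3/2` is open. -/
theorem trivial_bound (c : ℤ) (n n' M j : ℕ) (hj : Nat.sqrt M + 1 ≤ j) :
    |T c n n' M j| ≤ 3 * (M : ℝ) ^ (3 / 2 : ℝ) := by
  have hj1 : 1 ≤ j := le_trans (by omega) hj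
  have h0 := abs_cosetW_le (u n c) (u n' c) (abs_u_le_one n c) (abs_u_le_one n' c) M j hj1
  unfold T
  rcases Nat.eq_zero_or_pos M with hM | hM
  · subst hM
    simp only [CharP.cast_eq_zero, mul_zero] at h0
    have : (3 : ℝ) * (0 : ℝ) ^ (3 / 2 : ℝ) = 0 := by
      rw [Real.zero_rpow (by norm_num)]; ring
    rw [Nat.cast_zero, this]
    exact h0
  · have hMr : (0 : ℝ) < M := by exact_mod_cast hM
    have hM1 : (1 : ℝ) ≤ M := by exact_mod_cast hM
    have hsqrt_pos : 0 < Real.sqrt M := Real.sqrt_pos.mpr hMr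
    have hsqrt_one : 1 ≤ Real.sqrt M := by
      rw [show (1 : ℝ) = Real.sqrt 1 by simp]; exact Real.sqrt_le_sqrt hM1
    have hjr : Real.sqrt M ≤ (j : ℝ) := by
      have h1 := sqrt_lt_natSqrt_add_one M
      have h2 : ((Nat.sqrt M + 1 : ℕ) : ℝ) ≤ j := by exact_mod_cast hj
      linarith
    have hdiv : 2 * (M : ℝ) / j ≤ 2 * Real.sqrt M := by
      calc 2 * (M : ℝ) / j ≤ 2 * (M : ℝ) / Real.sqrt M :=
            div_le_div_of_nonneg_left (by positivity) hsqrt_pos hjr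
        _ = 2 * Real.sqrt M := by rw [mul_div_assoc, Real.div_sqrt]
    have hpow : (M : ℝ) ^ (3 / 2 : ℝ) = M * Real.sqrt M := by
      rw [show (3 / 2 : ℝ) = 1 + 1 / 2 by norm_num, Real.rpow_add hMr, Real.rpow_one,
        Real.sqrt_eq_rpow]
    calc |cosetW (u n c) (u n' c) M j| ≤ (2 * (M : ℝ) / j + 1) * M := h0
      _ ≤ (2 * Real.sqrt M + Real.sqrt M) * M := by
          refine mul_le_mul_of_nonneg_right ?_ hMr.le
          linarith
      _ = 3 * (M : ℝ) ^ (3 / 2 : ℝ) := by rw [hpow]; ring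

/-! ## §4 Natural strengthenings -/

/-- (b) ALL MODULI.  At `j = 1` the coset is the whole square and `T_1 = S(n)·S(n')`
(random size `M = M^{3/4+1/4}`): the lower end `j ≥ ⌊√M⌋+1` of the window is not decoration. -/
theorem pairs_one (M : ℕ) : pairs M 1 = Ioc M (2 * M) ×ˢ Ioc M (2 * M) := by
  unfold pairs
  exact filter_true_of_mem fun p _ => Nat.modEq_one

/-- `j = 1`: the coset sum is the product of the two block sums. -/
theorem modulus_one (f g : ℕ → ℝ) (M : ℕ) :
    cosetW f g M 1 = (∑ m ∈ Ioc M (2 * M), f m) * (∑ m ∈ Ioc M (2 * M), g m) := by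
  unfold cosetW
  rw [pairs_one, sum_product, sum_mul_sum]

/-- (c) NO UPPER LIMIT ON `j`.  For `j > M` two elements of `(M,2M]` congruent mod `j` are equal, so the
coset is the diagonal … -/
theorem pairs_eq_diag_of_lt (M j : ℕ) (hj : M < j) :
    pairs M j = (Ioc M (2 * M)).map ⟨fun m => (m, m), fun _ _ h => (Prod.ext_iff.mp h).1⟩ := by
  ext ⟨m, m'⟩
  simp only [pairs, mem_filter, mem_product, mem_Ioc, mem_map, Function.Embedding.coeFn_mk,
    Prod.mk.injEq]
  constructor
  · rintro ⟨⟨⟨hm1, hm2⟩, ⟨hm1', hm2'⟩⟩, hmod⟩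
    have key : m = m' := by
      rcases le_total m m' with h | h
      · have hd : j ∣ m' - m := (Nat.modEq_iff_dvd' h).mp hmod
        have hlt : m' - m < j := by omega
        have := Nat.eq_zero_of_dvd_of_lt hd hlt
        omega
      · have hd : j ∣ m - m' := (Nat.modEq_iff_dvd' h).mp hmod.symm
        have hlt : m - m' < j := by omega
        have := Nat.eq_zero_of_dvd_of_lt hd hlt
        omega
    exact ⟨m, ⟨hm1, hm2⟩, rfl, key⟩
  · rintro ⟨a, ⟨ha1, ha2⟩, rfl, rfl⟩
    exact ⟨⟨⟨ha1, ha2⟩, ⟨ha1, ha2⟩⟩, Nat.ModEq.refl _⟩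

/-- … and the coset sum IS the dilated two-point (Chowla) sum `Σ_m f(m) g(m)`: extending the window to all
large `j` turns the crux into a pointwise form of the node `DilatedChowla`. -/
theorem large_modulus_eq_diagonal (f g : ℕ → ℝ) (M j : ℕ) (hj : M < j) :
    cosetW f g M j = ∑ m ∈ Ioc M (2 * M), f m * g m := by
  unfold cosetW
  rw [pairs_eq_diag_of_lt M j hj, sum_map]
  rfl

/-- (a) SMALL MODEL.  At `M = 2`, `j = 2`: `P_2(2) = {(3,3),(4,4)}`. -/
theorem pairs_two_two : pairs 2 2 = {(3, 3), (4, 4)} := by decide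

/-- `T_2(1,2;c=1,M=2) = λ(4)λ(7) + λ(5)λ(9) = −2`. -/
theorem T_small : T 1 1 2 2 2 = -2 := by
  unfold T cosetW
  rw [pairs_two_two, sum_pair (by decide)]
  have e : ∀ k : ℕ, Int.toNat ((k : ℤ)) = k := fun k => Int.toNat_natCast k
  simp only [u]
  norm_num
  rw [show (4 : ℤ) = ((4 : ℕ) : ℤ) by norm_num, show (7 : ℤ) = ((7 : ℕ) : ℤ) by norm_num,
    show (5 : ℤ) = ((5 : ℕ) : ℤ) by norm_num, show (9 : ℤ) = ((9 : ℕ) : ℤ) by norm_num, e, e, e, e,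
    liouville_four, liouville_seven, liouville_five, liouville_nine]
  norm_num

/-- The UNIFORM-CONSTANT strengthening (`C = 1`, `ϑ = 0`, all `M ≥ 1`) is false already at `M = 2`
(`|T| = 2 > 2^{3/4}`): constants are genuinely needed; nothing deeper. -/
theorem not_uniformConstant :
    ¬ (∀ M n n' j : ℕ, 1 ≤ n → 1 ≤ n' → n ≠ n' → n ≤ 2 * M → n' ≤ 2 * M →
        Nat.sqrt M + 1 ≤ j → j < 2 * (Nat.sqrt M + 1) → |T 1 n n' M j| ≤ (M : ℝ) ^ (3 / 4 : ℝ)) := by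
  intro h
  have hs : Nat.sqrt 2 = 1 := by norm_num
  have := h 2 1 2 2 le_rfl (by norm_num) (by norm_num) (by norm_num) (by norm_num) (by rw [hs]) (by rw [hs]; norm_num)
  rw [T_small] at this
  have h2 : (2 : ℝ) ^ (3 / 4 : ℝ) < 2 := by
    calc (2 : ℝ) ^ (3 / 4 : ℝ) < (2 : ℝ) ^ (1 : ℝ) :=
          Real.rpow_lt_rpow_of_exponent_lt (by norm_num) (by norm_num)
      _ = 2 := Real.rpow_one 2
  norm_num at this
  linarith


/-! ## §5 Line `SketchIdeator3` (targets: none stuck; `payload.stuck_stubs = []`)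

Line SketchIdeator3.  Crux-grade stubs: K1 `stub_meanCorrectedCosetDecorrelation`, K2
`stub_progressionMeanPowerSaving`; periphery P1–P7 (P1–P5 LANDED as Theorems files, P6–P7 registered 2026-08-16).
Attacks run on the line (all negative = nothing broke):
* K1 at aligned shifts = autocorrelation of the λ profile minus `λ(n)λ(n')·S_a S_b/j` (`aligned_shift` + mean
  coupling): same bounded-lag core as the crux; numerically the level-1 term is ≤ 0.25·M^{3/4} and decays (ideator 2
  §A, this file §7A `mean_j` column), so K1 ≈ crux in data; K1 is false for real-character pretenders (memo F2) —
  a MODEL statement, not a refutation.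
* K2: not implied by the crux (crux ⇒ only the ℓ¹ average `Σ_{n≤N}|S(n)| ≤ C(M√N + N M^{3/4−κ/2})`, lead's landed
  `stub_calibrationL1`); K2(n=1) ⇒ quasi-RH(3/4−κ/2) (lead's landed P5) — cannot be refuted without refuting RH;
  K2(n ≍ M): Montgomery-grade, random size √M·√(2 log 2M) ≈ 5√M at M = 10⁵ vs allowance C·M^{3/4−κ/2}: margin
  M^{1/4−κ/2}; §7C scan max 3.07√M.  Structured moduli (primorial multiples: all arguments coprime to every p ≤ 13;
  powers of 2; n = Q, Q², M, 2M) show nothing: forcing roughness through the modulus only reaches primes ≤ log M,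
  where the rough-λ bias `Φ_λ(x,y) = Σ_{d∣P(y)} L(x/d) ≈ √x·Π_{p≤y}(1+p^{-1/2})/ζ(1/2)` is invisible per class
  (relative size x^{-1/2}·e^{O(√y/log y)} ≪ (x/q)^{-1/2}).
* Joint sufficiency `K2 → K1 → crux` and honesty `crux ∧ K2 ↔ K1 ∧ K2` are kernel-checked by the lead; the re-cut
  P7 (`stub_meanFreeEngine`) needs the one-point input only at depth `1−κ` — still quasi-RH(1−κ)-grade at n = 1
  (no zero-free strip is known), i.e. every version of the line carries a ζ-hypothesis; recorded, not attackable. -/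

/-! ## §6 Near-misses and reformulations (for ideators) -/

/-- THE BOUNDED-LAG CORE at `(n,n';c) = (1,2;2)`: `T_j(1,2;2) = −Σ_{m≡m' (j)} λ(m+2)λ(m'+1)` — the crux here is
EXACTLY the statement that the class-sum profile of `λ` on a dyadic block decorrelates (at the power scale `M^{3/4+ϑ}`)
from its own translate by ONE unit, equivalently `Σ_{h ≡ 1 (mod j), |h| < M} C_M(h) ≪ M^{3/4+ϑ}` for the two-point
Chowla sums `C_M(h) = Σ_m λ(m)λ(m+h)` (≈ 2M/j ≍ √M shifts in arithmetic progression; square-root cancellation ACROSS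
shifts beyond square-root cancellation within each).  Any ideator mechanism should be tested on this instance first:
it has no dilation, no level, no progression — only `λ` against `λ`. -/
theorem core_one_two (M j : ℕ) :
    T 2 1 2 M j = -cosetW (fun m => (ArithmeticFunction.liouville (m + 2) : ℝ))
      (fun m => (ArithmeticFunction.liouville (m + 1) : ℝ)) M j := by
  rw [aligned_shift 1 2 2 1 2 (by norm_num) (by norm_num) M j, ArithmeticFunction.liouville_apply_one,
    liouville_two]
  have e2 : ∀ m : ℕ, Int.toNat ((m : ℤ) + 2) = m + 2 := fun m => by
    rw [show ((m : ℤ) + 2) = ((m + 2 : ℕ) : ℤ) by push_cast; ring, Int.toNat_natCast]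
  have e1 : ∀ m : ℕ, Int.toNat ((m : ℤ) + 1) = m + 1 := fun m => by
    rw [show ((m : ℤ) + 1) = ((m + 1 : ℕ) : ℤ) by push_cast; ring, Int.toNat_natCast]
  simp only [e1, e2]
  push_cast
  ring

/-! ### §6b The real-character PRETENDER (model computation, not formalised — a statement about `χ`, not `λ`)
For a real primitive character `χ` of prime conductor `q ∣ j`, `q ∤ c(n−n')nn'`, put `T_j^χ = Σ_{m≡m' (j)} χ(mn+c)χ(m'n'+c)`.
Since `q ∣ j`, `m' ≡ m (mod q)` on the coset, so `χ(m'n'+c) = χ(mn'+c)` and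
`T_j^χ = Σ_m N_j(m)·χ((mn+c)(mn'+c))`, `N_j(m) = #{m' ∈ (M,2M] : m' ≡ m (j)} ∈ {⌊M/j⌋, ⌈M/j⌉}`.  Over a full period,
Jacobsthal: `Σ_{x mod q} χ((xn+c)(xn'+c)) = χ(nn')·Σ_x χ((x+c/n)(x+c/n')) = −χ(nn')` (discriminant `c²(n−n')² ≢ 0`), hence
`T_j^χ = −χ(nn')·(M/j)(M/q) + O(M/j·q + M/q + j)`, i.e. `|T_j^χ| ≍ M^{3/2}/(jq) ≍ M/q` for `j ≍ √M`: the crux FAILS for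
the pretender whenever `q < M^{1/4−ϑ}`, and holds (class sums `A^χ(a) = O(q)`) when `cond χ ∤ jn, jn'` (memo F2).  For `λ`
this is the Landau–Siegel caricature of the route file; §7D finds no shadow of it at any `q ≤ 163`, `M ≤ 10⁷`.
A proof of the crux must therefore spend power-scale non-pretentiousness of `λ` against real characters of conductor
`≤ 2√M+2` — Siegel-ineffective territory; a disproof would have to exhibit the opposite. -/

end Summit.Parity.GeneralizedHardyLittlewood.Cruxes.CosetDecorrelation.Disproof
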